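import Summits.Ventures.YMGap.RobustBall.SummableMassGap
import Summits.Ventures.YMGap.RobustBall.LatticeSumL1
import Summits.Ventures.YMGap.Thresholds.PlaquetteSusceptibility
import HarnessLib

/-!
# Venture YMGap, track ROBUST-BALL (Y2) — TIER 2: THE STATIC SUSCEPTIBILITY OF EVERY LOCAL OBSERVABLE AGAINST EVERY
# DIRECTION OF THE WEIGHTED BALL IS AN ABSOLUTELY CONVERGENT SERIES, UNIFORMLY ON THE BALL

HONEST FRAMING. WHAT THIS IS: a venture file (cell `pub-ymgap`, track Y2 ROBUST-BALL, seat rb-p1, theorems only).  A DIRECTION of the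
tier-2 ball is a link potential `V = (V_X)_X` on `ℤ^d` with continuous own-link terms and coordinatewise Frobenius-Lipschitz witnesses
`lipV_X` whose TOTAL LIPSCHITZ LOAD through every link is bounded, `Σ'_{X ∋ e} Σ_{y ∈ X} lipV_X(y) ≤ L` (every term of the action the cell
has typed — plaquettes, rectangles, loops of any size, pair couplings — is such a direction).  For a member `W` of the weighted ball inside
the one-link pair door `ρ := 6(d−1)|β| e^{a} e^{t} √(cv) + e^{a/2} √c Λ_t < 1` (weight `t > 0`) and ANY of its DLR states `μ`:
* `abs_cov_le_of_isLipBound_S` — the door's covariance bound in its natural (coordinatewise-Lipschitz) currency: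
  `|cov_μ(f, g)| ≤ 8N (Σ_{Δg} δ_g)(Σ_{Δf} δ_f) e^{−t d(Δf, Δg)}` (Föllmer's comparison estimate; the cylinder form with `n²` is
  `perturbed_covariance_decay_S`);
* `abs_cov_term_le_S` — against one term of a direction: `|cov_μ(f, V_X)| ≤ 8N (Σ_{Δf} δ_f) · (Σ_{y∈X} lipV_X y) · Σ_{e ∈ X} e^{−t dist(e, Δf)}`;
* `sum_exp_neg_linkSetDist_le` / `summable_exp_neg_linkSetDist` — the lattice sum `Σ_e e^{−t dist(e, Δ)} ≤ #Δ · d · ((1+r)/(1−r))^d`,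
  `r = e^{−t/d}`;
* ★ `summable_abs_cov_direction_S` — THE SUSCEPTIBILITY SERIES CONVERGES ABSOLUTELY: `X ↦ |cov_μ(f, V_X)|` is summable over ALL finite
  link sets and `Σ_X |cov_μ(f, V_X)| ≤ 8N (Σ_{Δf} δ_f) · L · #Δf · d · ((1+r)/(1−r))^d` — ONE constant for every member of the ball and
  every DLR state (the static response of `f` to the direction `V`, cf. `StateDerivativeOnBallS.lean` where it IS the derivative);
* `su2_summable_abs_cov_direction_dim4` — `SU(2)`, `ℤ⁴`, hypothesis-free on `MemBallZdS a Λ t` (`6|β_W| e^{a} e^{t} + e^{a/2} √(2/3) Λ < 1`,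
  `t > 0`), Lipschitz cylinder `F`: `Σ_X |cov_μ(F, V_X)| ≤ 64 · (#Λ_F)² K_F · L · ((1+e^{−t/4})/(1−e^{−t/4}))⁴`.
WHAT THIS IS NOT: a one-sided (Dobrushin-comparison) bound; lattice strong coupling only; nothing about the continuum limit or a
Clay-sense mass gap.  ds-1's `LinearResponseBound.lean` is the Wilson-plaquette direction at the Wilson point from `MassGapAt`.
-/

noncomputable section

open MeasureTheory Function Finset ProbabilityTheory Real
open scoped NNReal
open Literature.Probability.LatticeModels
open Literature.Probability.LatticeModels.DobrushinMetric
open Literature.MathematicalPhysics.QuantumLattice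
open Literature.MathematicalPhysics.QuantumFieldTheory hiding ZdEdge
open Summit.QuantumFields.BalabanUV.InfraRed.StrongCouplingPoincareDoorSUN (oneLinkPoincareSUN_two_sharp)
open Summit.Ventures.YMGap.PlaquetteSusceptibility (l1_le_mul_norm)

namespace Summit.Ventures.YMGap.RobustBall

variable {d N : ℕ}

/-! ### The lattice sum `Σ_e e^{−t dist(e, Δ)}` -/

/-- A partial sum over links of a function of the base point is at most `d` times a bound on the partial sums over base points. -/
theorem sum_link_base_le {f : Site d → ℝ} (hf : ∀ x, 0 ≤ f x) {G : ℝ} (hG : ∀ F : Finset (Site d), ∑ x ∈ F, f x ≤ G)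
    (S : Finset (ZdEdge d)) : ∑ e ∈ S, f e.1 ≤ d * G := by
  classical
  have hsub : S ⊆ (S.image Prod.fst) ×ˢ (univ : Finset (Fin d)) :=
    fun e he => mem_product.2 ⟨mem_image.2 ⟨e, he, rfl⟩, mem_univ _⟩
  calc ∑ e ∈ S, f e.1 ≤ ∑ e ∈ (S.image Prod.fst) ×ˢ (univ : Finset (Fin d)), f e.1 :=
        sum_le_sum_of_subset_of_nonneg hsub fun e _ _ => hf _
    _ = ∑ x ∈ S.image Prod.fst, (d : ℝ) * f x := by
        rw [sum_product]
        refine sum_congr rfl fun x _ => ?_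
        change ∑ _i : Fin d, f x = _
        rw [sum_const, nsmul_eq_mul, card_univ, Fintype.card_fin]
    _ = d * ∑ x ∈ S.image Prod.fst, f x := by rw [mul_sum]
    _ ≤ d * G := mul_le_mul_of_nonneg_left (hG _) (Nat.cast_nonneg _)

/-- `e^{−t‖v‖_∞} ≤ (e^{−t/d})^{‖v‖₁}` for `t ≥ 0` (`‖v‖₁ ≤ d‖v‖_∞`). -/
theorem exp_neg_norm_le_pow_l1 (hd : 1 ≤ d) {t : ℝ} (ht : 0 ≤ t) (v : Site d) :
    exp (-t * ‖v‖) ≤ exp (-(t / d)) ^ l1 v := by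
  have hd0 : (0 : ℝ) < d := by exact_mod_cast hd
  rw [← Real.exp_nat_mul]
  refine exp_le_exp.2 ?_
  have h1 : (l1 v : ℝ) ≤ d * ‖v‖ := l1_le_mul_norm v
  have h2 : (l1 v : ℝ) * (t / d) ≤ t * ‖v‖ := by
    rw [mul_div_assoc', div_le_iff₀ hd0]; nlinarith
  linarith

/-- **The lattice sum.**  For `t ≥ 0` with `r := e^{−t/d} < 1` (i.e. `t > 0`) and a nonempty finite link set `Δ`, every partial sum of
`e ↦ e^{−t·dist(e, Δ)}` over links of `ℤ^d` is at most `#Δ · d · ((1+r)/(1−r))^d`. -/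
theorem sum_exp_neg_linkSetDist_le (hd : 1 ≤ d) {t : ℝ} (ht : 0 < t) {Δ : Finset (ZdEdge d)} (hΔ : Δ.Nonempty)
    (S : Finset (ZdEdge d)) :
    ∑ e ∈ S, exp (-t * linkSetDist Δ e) ≤ Δ.card * (d * ((1 + exp (-(t / d))) / (1 - exp (-(t / d)))) ^ d) := by
  classical
  set r : ℝ := exp (-(t / d)) with hr
  have hr0 : 0 ≤ r := (exp_pos _).le
  have hd0 : (0 : ℝ) < d := by exact_mod_cast hd
  have hr1 : r < 1 := exp_lt_one_iff.2 (by rw [neg_lt_zero]; positivity)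
  have hpt : ∀ e, exp (-t * linkSetDist Δ e) ≤ ∑ y ∈ Δ, r ^ l1 (y.1 - e.1) := fun e => by
    obtain ⟨y₀, hy₀, heq⟩ := Finset.exists_mem_eq_inf' hΔ (fun y' : ZdEdge d => ‖e.1 - y'.1‖)
    have hD : linkSetDist Δ e = ‖e.1 - y₀.1‖ := by unfold linkSetDist; rw [dif_pos hΔ, heq]
    calc exp (-t * linkSetDist Δ e) = exp (-t * ‖y₀.1 - e.1‖) := by rw [hD, norm_sub_rev]
      _ ≤ r ^ l1 (y₀.1 - e.1) := exp_neg_norm_le_pow_l1 hd ht.le _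
      _ ≤ ∑ y ∈ Δ, r ^ l1 (y.1 - e.1) :=
          single_le_sum (f := fun y : ZdEdge d => r ^ l1 (y.1 - e.1)) (fun y _ => pow_nonneg hr0 _) hy₀
  calc ∑ e ∈ S, exp (-t * linkSetDist Δ e) ≤ ∑ e ∈ S, ∑ y ∈ Δ, r ^ l1 (y.1 - e.1) := sum_le_sum fun e _ => hpt e
    _ = ∑ y ∈ Δ, ∑ e ∈ S, r ^ l1 (y.1 - e.1) := sum_comm
    _ ≤ ∑ _y ∈ Δ, (d : ℝ) * ((1 + r) / (1 - r)) ^ d :=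
        sum_le_sum fun y _ => sum_link_base_le (f := fun x => r ^ l1 (y.1 - x)) (fun x => pow_nonneg hr0 _)
          (fun F => sum_pow_l1_sub_le hr0 hr1 y.1 F) S
    _ = Δ.card * (d * ((1 + r) / (1 - r)) ^ d) := by rw [sum_const, nsmul_eq_mul]

/-- Summability form of the lattice sum, with the same bound on the total. -/
theorem summable_exp_neg_linkSetDist (hd : 1 ≤ d) {t : ℝ} (ht : 0 < t) {Δ : Finset (ZdEdge d)} (hΔ : Δ.Nonempty) :
    Summable (fun e : ZdEdge d => exp (-t * linkSetDist Δ e)) ∧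
      ∑' e : ZdEdge d, exp (-t * linkSetDist Δ e) ≤ Δ.card * (d * ((1 + exp (-(t / d))) / (1 - exp (-(t / d)))) ^ d) :=
  ⟨summable_of_sum_le (fun _ => (exp_pos _).le) (sum_exp_neg_linkSetDist_le hd ht hΔ),
    Real.tsum_le_of_sum_le (fun _ => (exp_pos _).le) (sum_exp_neg_linkSetDist_le hd ht hΔ)⟩

/-! ### The door's covariance bound in the coordinatewise-Lipschitz currency -/

section SUN

variable {W V : Potential (ZdEdge d) (Matrix.specialUnitaryGroup (Fin N) ℂ)} {B : Finset (ZdEdge d) → ℝ}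

/-- **The pair door's covariance bound, natural currency.**  Member `W` (continuous, link-summable, tier-2 loads `a`, `Λ_t` at weight
`t ≥ 0`) inside `ρ := 6(d−1)|β| e^{a} e^{t} √(c v) + e^{a/2} √c Λ_t < 1`; every DLR `μ` and every two bounded measurable local observables
`f` (on `Δf`, Frobenius-Lipschitz vector `δf`) and `g` (on `Δg`, `δg`): `|cov_μ(f, g)| ≤ 2(2√N)² (Σ_{Δg} δg)(Σ_{Δf} δf) e^{−t d(Δf, Δg)}`. -/
theorem abs_cov_le_of_isLipBound_S (hd : 1 ≤ d) (hN : 1 ≤ N) {β b c v a Λt t : ℝ}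
    (hc : 0 ≤ c) (hv : 0 ≤ v) (hb : |β| * (2 * ((d : ℝ) - 1)) ≤ b)
    (hP : ∀ B : Matrix (Fin N) (Fin N) ℂ, matrixOpNorm B ≤ b →
      ∀ (ψ : Matrix.specialUnitaryGroup (Fin N) ℂ → ℝ) (M : ℝ), 0 ≤ M →
        (∀ x y, |ψ x - ψ y| ≤ M * suFrobDist x y) →
        Var[ψ; (haarProbability (Matrix.specialUnitaryGroup (Fin N) ℂ)).tilted
          fun g => (N : ℝ) * ((g : Matrix (Fin N) (Fin N) ℂ) * B).trace.re] ≤ c * M ^ 2)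
    (hVB : ∀ B : Matrix (Fin N) (Fin N) ℂ, matrixOpNorm B ≤ b → ∀ Δ : Matrix (Fin N) (Fin N) ℂ,
      Var[fun g : Matrix.specialUnitaryGroup (Fin N) ℂ =>
          (N : ℝ) * ((g : Matrix (Fin N) (Fin N) ℂ) * Δ).trace.re;
        (haarProbability (Matrix.specialUnitaryGroup (Fin N) ℂ)).tilted
          fun g => (N : ℝ) * ((g : Matrix (Fin N) (Fin N) ℂ) * B).trace.re] ≤ v * frobNorm Δ ^ 2)
    (h : IsLinkSummable W B) (hWc : ∀ X, Continuous (W X))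
    (hWdep : ∀ X, DependsOn (W X) (↑X : Set (ZdEdge d)))
    {osc : Finset (ZdEdge d) → ZdEdge d → ℝ} (hosc : ∀ X, Dobrushin.IsOscBound (W X) (osc X))
    (hoscs : ∀ e, Summable fun X : Finset (ZdEdge d) => (if e ∈ X then osc X e else 0))
    (hosca : ∀ e, ∑' X : Finset (ZdEdge d), (if e ∈ X then osc X e else 0) ≤ a)
    {lip : Finset (ZdEdge d) → ZdEdge d → ℝ} (hlip : ∀ X, IsLipBound suFrobDist (W X) (lip X))
    {ℓ : ZdEdge d → ZdEdge d → ℝ}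
    (hlips : ∀ e y, Summable fun X : Finset (ZdEdge d) => (if e ∈ X ∧ y ∈ X then lip X y else 0))
    (hℓ : ∀ e y, y ≠ e → ∑' X : Finset (ZdEdge d), (if e ∈ X ∧ y ∈ X then lip X y else 0) ≤ ℓ e y)
    (ht : 0 ≤ t) (hℓs : ∀ e, Summable fun y => (if y = e then 0 else ℓ e y) * exp (t * ‖e.1 - y.1‖))
    (hℓt : ∀ e, ∑' y, (if y = e then 0 else ℓ e y) * exp (t * ‖e.1 - y.1‖) ≤ Λt)
    (hρ : 6 * ((d : ℝ) - 1) * |β| * (exp a * exp t * Real.sqrt (c * v)) + exp (a / 2) * Real.sqrt c * Λt < 1)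
    {μ : Measure (LGConfig d (Matrix.specialUnitaryGroup (Fin N) ℂ))}
    (hμ : μ ∈ perturbedGibbsMeasuresS (d := d) (fundamentalRep (Fin N)) (N * β) W)
    {f : LGConfig d (Matrix.specialUnitaryGroup (Fin N) ℂ) → ℝ} (hfm : Measurable f) {Δf : Finset (ZdEdge d)}
    (hfdep : DependsOn f (↑Δf : Set (ZdEdge d))) {Mf : ℝ} (hMf : ∀ σ, |f σ| ≤ Mf) {δf : ZdEdge d → ℝ}
    (hδf : IsLipBound suFrobDist f δf)
    {g : LGConfig d (Matrix.specialUnitaryGroup (Fin N) ℂ) → ℝ} (hgm : Measurable g) {Δg : Finset (ZdEdge d)}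
    (hgdep : DependsOn g (↑Δg : Set (ZdEdge d))) {Mg : ℝ} (hMg : ∀ σ, |g σ| ≤ Mg) {δg : ZdEdge d → ℝ}
    (hδg : IsLipBound suFrobDist g δg) :
    |cov[f, g; μ]| ≤ 2 * (2 * Real.sqrt N) ^ 2 * (∑ y ∈ Δg, δg y) * (∑ y ∈ Δf, δf y) * exp (-(t * setDistEdges Δf Δg)) := by
  classical
  haveI : SecondCountableTopology (Matrix (Fin N) (Fin N) ℂ) :=
    inferInstanceAs (SecondCountableTopology (Fin N → Fin N → ℂ))
  haveI : SecondCountableTopology (Matrix.specialUnitaryGroup (Fin N) ℂ) :=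
    Topology.IsEmbedding.subtypeVal.secondCountableTopology
  have hγ : IsSpecification (perturbedYMS (d := d) (fundamentalRep (Fin N)) (N * β) W) :=
    isSpecification_perturbedYMS _ (continuous_fundamentalRep (Fin N)) _ h hWc hWdep
  have hℓ0 : ∀ x y, y ≠ x → 0 ≤ ℓ x y := fun x y hyx => by
    refine le_trans (tsum_nonneg fun X => ?_) (hℓ x y hyx)
    split_ifs
    · exact (hlip X).nonneg y
    · exact le_rfl
  have hrow := fun x => summable_coeffS_row₀ (β := β) (c := c) (v := v) (a := a) hd hℓ0 ht hℓs hℓt x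
  have hℓs' : ∀ e, Summable fun y => (if y = e then 0 else ℓ e y) := fun e =>
    Summable.of_nonneg_of_le (fun y => by split_ifs with hye; exacts [le_rfl, hℓ0 e y hye])
      (fun y => le_mul_of_one_le_right (by split_ifs with hye; exacts [le_rfl, hℓ0 e y hye])
        (one_le_exp (by positivity))) (hℓs e)
  have hC0 : ∀ x y : ZdEdge d, 0 ≤ (if y = x then 0 else
      (exp a * Real.sqrt (c * v) * |β| * linkInfluence x y + exp (a / 2) * Real.sqrt c * ℓ x y)) :=
    fun x y => by
      split_ifs with hyx
      · exact le_rfl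
      · exact add_nonneg (by positivity) (mul_nonneg (by positivity) (hℓ0 x y hyx))
  have hρ0 : 0 ≤ 6 * ((d : ℝ) - 1) * |β| * (exp a * exp t * Real.sqrt (c * v)) + exp (a / 2) * Real.sqrt c * Λt := by
    have hd0 : 0 < d := hd
    let e₀ : ZdEdge d := (0, ⟨0, hd0⟩)
    exact (tsum_nonneg (hC0 e₀)).trans (hrow e₀).2.2.1
  have hRsqrt : (0 : ℝ) ≤ 2 * Real.sqrt N := by positivity
  have hμ' : IsGibbsMeasure (perturbedYMS (d := d) (fundamentalRep (Fin N)) (N * β) W) μ := hμ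
  haveI := hμ'.isProbabilityMeasure
  exact abs_covariance_le_of_summable_exp_dist hγ (fun _ _ => suFrobDist_nonneg _ _) suFrobDist_le
    hRsqrt suFrobDist_self hC0 (fun x => (hrow x).1)
    (fun x ω η φ L hφm hφb hL hφL => abs_integral_siteLaw_perturbedYMS_sub_le_tsum₀ hd hN hc hv hb hP hVB
      h hWc hWdep hosc hoscs hosca hlip hlips hℓ hℓs' x ω η φ L hφm hφb hL hφL)
    hμ' hfm hfdep hMf hδf hgm hgdep hMg hδg
    hρ0 hρ (fun x y : ZdEdge d => ‖x.1 - y.1‖) (fun _ _ => norm_nonneg _) ht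
    (fun x _ => (hrow x).2.1) (fun x _ => (hrow x).2.2.2) (linkSetDist Δg) (linkSetDist_nonneg Δg)
    (fun y hy => linkSetDist_eq_zero_of_mem hy) (fun x _ y => linkSetDist_le_add_norm Δg x y)
    (m := setDistEdges Δf Δg) (fun y hy => setDistEdges_le_linkSetDist hy)

end SUN

/-! ### The susceptibility series -/

/-- From a covariance bound `e^{−t d(Δf, X)}` to the summable profile `Σ_{e ∈ X} e^{−t dist(e, Δf)}`: with `A, LX ≥ 0`,
`A · LX · e^{−t d(Δf, X)} ≤ A · LX · Σ_{e∈X} e^{−t dist(e,Δf)}` whenever `X` and `Δf` are nonempty, and both sides vanish with `LX` or `A`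
otherwise — packaged as: `|c| ≤ A LX e^{−t d}` and (`X = ∅ → LX = 0`) and (`Δf = ∅ → A = 0`) imply `|c| ≤ A LX Σ_{e∈X} e^{−t dist(e,Δf)}`. -/
theorem le_mul_sum_exp_of_le_mul_exp {t A LX cabs : ℝ} (ht : 0 ≤ t) (hA : 0 ≤ A) (hLX : 0 ≤ LX)
    {Δf X : Finset (ZdEdge d)} (hc : cabs ≤ A * LX * exp (-(t * setDistEdges Δf X)))
    (hX : ¬ X.Nonempty → LX = 0) (hΔ : ¬ Δf.Nonempty → A = 0) :
    cabs ≤ A * LX * ∑ e ∈ X, exp (-t * linkSetDist Δf e) := by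
  by_cases hXn : X.Nonempty
  · by_cases hΔn : Δf.Nonempty
    · -- the set distance is attained at a pair `(u, w) ∈ Δf × X` (as in `SourceGeometry.exists_setDistEdges_eq`)
      obtain ⟨u, hu, w, hw, heq⟩ : ∃ u ∈ Δf, ∃ w ∈ X, setDistEdges Δf X = ‖u.1 - w.1‖ := by
        have hne : (Δf ×ˢ X).Nonempty := hΔn.product hXn
        obtain ⟨p, hp, hpeq⟩ := Finset.exists_mem_eq_inf' hne (fun p : ZdEdge d × ZdEdge d => ‖p.1.1 - p.2.1‖)
        exact ⟨p.1, (Finset.mem_product.1 hp).1, p.2, (Finset.mem_product.1 hp).2, by rw [setDistEdges, dif_pos hne, hpeq]⟩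
      refine hc.trans (mul_le_mul_of_nonneg_left ?_ (mul_nonneg hA hLX))
      have h1 : linkSetDist Δf w ≤ ‖u.1 - w.1‖ := by
        unfold linkSetDist
        rw [dif_pos hΔn, norm_sub_rev]
        exact Finset.inf'_le _ hu
      calc exp (-(t * setDistEdges Δf X)) ≤ exp (-t * linkSetDist Δf w) := exp_le_exp.2 (by rw [heq]; nlinarith)
        _ ≤ ∑ e ∈ X, exp (-t * linkSetDist Δf e) :=
            single_le_sum (f := fun e => exp (-t * linkSetDist Δf e)) (fun e _ => (exp_pos _).le) hw
    · rw [hΔ hΔn, zero_mul, zero_mul] at hc ⊢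
      exact hc
  · rw [hX hXn, mul_zero, zero_mul] at hc ⊢
    exact hc

/-- **Bookkeeping for the series**: for every finite family `T` of link sets, nonnegative `g` summable over links and per-set loads `LX ≥ 0`
with `Σ'_{X ∋ e} LX ≤ L` (`L ≥ 0`) through every link: `Σ_{X ∈ T} LX · Σ_{e ∈ X} g e ≤ L · Σ'_e g e`. -/
theorem sum_mul_sum_le_of_load {T : Finset (Finset (ZdEdge d))} {g : ZdEdge d → ℝ} (hg0 : ∀ e, 0 ≤ g e) (hgs : Summable g)
    {LX : Finset (ZdEdge d) → ℝ} (hLX0 : ∀ X, 0 ≤ LX X) {L : ℝ} (hL0 : 0 ≤ L)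
    (hLs : ∀ e, Summable fun X : Finset (ZdEdge d) => (if e ∈ X then LX X else 0))
    (hL : ∀ e, ∑' X : Finset (ZdEdge d), (if e ∈ X then LX X else 0) ≤ L) :
    ∑ X ∈ T, LX X * ∑ e ∈ X, g e ≤ L * ∑' e, g e := by
  classical
  set U : Finset (ZdEdge d) := T.biUnion id with hU
  have hXU : ∀ X ∈ T, X ⊆ U := fun X hX e he => Finset.mem_biUnion.2 ⟨X, hX, he⟩
  calc ∑ X ∈ T, LX X * ∑ e ∈ X, g e
      = ∑ X ∈ T, ∑ e ∈ U, (if e ∈ X then LX X else 0) * g e := by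
        refine sum_congr rfl fun X hX => ?_
        rw [mul_sum, ← sum_subset (hXU X hX) (fun e _ heX => by rw [if_neg heX, zero_mul])]
        exact sum_congr rfl fun e he => by rw [if_pos he]
    _ = ∑ e ∈ U, (∑ X ∈ T, (if e ∈ X then LX X else 0)) * g e := by rw [sum_comm]; simp only [sum_mul]
    _ ≤ ∑ e ∈ U, L * g e := sum_le_sum fun e _ => mul_le_mul_of_nonneg_right
        (((hLs e).sum_le_tsum _ (fun X _ => by split_ifs; exacts [hLX0 X, le_rfl])).trans (hL e)) (hg0 e)
    _ = L * ∑ e ∈ U, g e := by rw [mul_sum]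
    _ ≤ L * ∑' e, g e := mul_le_mul_of_nonneg_left (hgs.sum_le_tsum _ (fun e _ => hg0 e)) hL0

section Series

variable {W V : Potential (ZdEdge d) (Matrix.specialUnitaryGroup (Fin N) ℂ)} {B : Finset (ZdEdge d) → ℝ}

/-- ★ **THE SUSCEPTIBILITY SERIES OF A LOCAL OBSERVABLE AGAINST A DIRECTION OF THE BALL CONVERGES ABSOLUTELY, UNIFORMLY ON THE BALL.**
Member `W` inside the pair door at weight `t > 0` (hypotheses as in `abs_cov_le_of_isLipBound_S`), ANY DLR state `μ`; observable `f`
(bounded measurable, local on `Δf`, Frobenius-Lipschitz vector `δf`); direction `V` (measurable own-link terms, bounded, coordinatewise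
Frobenius-Lipschitz witnesses `lipV_X` with total Lipschitz load `Σ'_{X ∋ e} Σ_{y∈X} lipV_X y ≤ L` through every link).  Then
`X ↦ |cov_μ(f, V_X)|` is summable over all finite link sets and
`Σ_X |cov_μ(f, V_X)| ≤ 2(2√N)² (Σ_{Δf} δf) · L · #Δf · d · ((1+r)/(1−r))^d`, `r = e^{−t/d}`. -/
theorem summable_abs_cov_direction_S (hd : 1 ≤ d) (hN : 1 ≤ N) {β b c v a Λt t : ℝ}
    (hc : 0 ≤ c) (hv : 0 ≤ v) (hb : |β| * (2 * ((d : ℝ) - 1)) ≤ b)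
    (hP : ∀ B : Matrix (Fin N) (Fin N) ℂ, matrixOpNorm B ≤ b →
      ∀ (ψ : Matrix.specialUnitaryGroup (Fin N) ℂ → ℝ) (M : ℝ), 0 ≤ M →
        (∀ x y, |ψ x - ψ y| ≤ M * suFrobDist x y) →
        Var[ψ; (haarProbability (Matrix.specialUnitaryGroup (Fin N) ℂ)).tilted
          fun g => (N : ℝ) * ((g : Matrix (Fin N) (Fin N) ℂ) * B).trace.re] ≤ c * M ^ 2)
    (hVB : ∀ B : Matrix (Fin N) (Fin N) ℂ, matrixOpNorm B ≤ b → ∀ Δ : Matrix (Fin N) (Fin N) ℂ,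
      Var[fun g : Matrix.specialUnitaryGroup (Fin N) ℂ =>
          (N : ℝ) * ((g : Matrix (Fin N) (Fin N) ℂ) * Δ).trace.re;
        (haarProbability (Matrix.specialUnitaryGroup (Fin N) ℂ)).tilted
          fun g => (N : ℝ) * ((g : Matrix (Fin N) (Fin N) ℂ) * B).trace.re] ≤ v * frobNorm Δ ^ 2)
    (h : IsLinkSummable W B) (hWc : ∀ X, Continuous (W X))
    (hWdep : ∀ X, DependsOn (W X) (↑X : Set (ZdEdge d)))
    {osc : Finset (ZdEdge d) → ZdEdge d → ℝ} (hosc : ∀ X, Dobrushin.IsOscBound (W X) (osc X))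
    (hoscs : ∀ e, Summable fun X : Finset (ZdEdge d) => (if e ∈ X then osc X e else 0))
    (hosca : ∀ e, ∑' X : Finset (ZdEdge d), (if e ∈ X then osc X e else 0) ≤ a)
    {lip : Finset (ZdEdge d) → ZdEdge d → ℝ} (hlip : ∀ X, IsLipBound suFrobDist (W X) (lip X))
    {ℓ : ZdEdge d → ZdEdge d → ℝ}
    (hlips : ∀ e y, Summable fun X : Finset (ZdEdge d) => (if e ∈ X ∧ y ∈ X then lip X y else 0))
    (hℓ : ∀ e y, y ≠ e → ∑' X : Finset (ZdEdge d), (if e ∈ X ∧ y ∈ X then lip X y else 0) ≤ ℓ e y)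
    (ht : 0 < t) (hℓs : ∀ e, Summable fun y => (if y = e then 0 else ℓ e y) * exp (t * ‖e.1 - y.1‖))
    (hℓt : ∀ e, ∑' y, (if y = e then 0 else ℓ e y) * exp (t * ‖e.1 - y.1‖) ≤ Λt)
    (hρ : 6 * ((d : ℝ) - 1) * |β| * (exp a * exp t * Real.sqrt (c * v)) + exp (a / 2) * Real.sqrt c * Λt < 1)
    {μ : Measure (LGConfig d (Matrix.specialUnitaryGroup (Fin N) ℂ))}
    (hμ : μ ∈ perturbedGibbsMeasuresS (d := d) (fundamentalRep (Fin N)) (N * β) W)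
    {f : LGConfig d (Matrix.specialUnitaryGroup (Fin N) ℂ) → ℝ} (hfm : Measurable f) {Δf : Finset (ZdEdge d)}
    (hfdep : DependsOn f (↑Δf : Set (ZdEdge d))) {Mf : ℝ} (hMf : ∀ σ, |f σ| ≤ Mf) {δf : ZdEdge d → ℝ}
    (hδf : IsLipBound suFrobDist f δf)
    (hVm : ∀ X, Measurable (V X)) (hVdep : ∀ X, DependsOn (V X) (↑X : Set (ZdEdge d)))
    (hVb : ∀ X, ∃ C, ∀ U, |V X U| ≤ C)
    {lipV : Finset (ZdEdge d) → ZdEdge d → ℝ} (hlipV : ∀ X, IsLipBound suFrobDist (V X) (lipV X)) {L : ℝ}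
    (hLs : ∀ e, Summable fun X : Finset (ZdEdge d) => (if e ∈ X then ∑ y ∈ X, lipV X y else 0))
    (hL : ∀ e, ∑' X : Finset (ZdEdge d), (if e ∈ X then ∑ y ∈ X, lipV X y else 0) ≤ L) :
    Summable (fun X : Finset (ZdEdge d) => |cov[f, V X; μ]|) ∧
      ∑' X : Finset (ZdEdge d), |cov[f, V X; μ]| ≤ 2 * (2 * Real.sqrt N) ^ 2 * (∑ y ∈ Δf, δf y) * L *
        (Δf.card * (d * ((1 + exp (-(t / d))) / (1 - exp (-(t / d)))) ^ d)) := by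
  classical
  set A : ℝ := 2 * (2 * Real.sqrt N) ^ 2 * (∑ y ∈ Δf, δf y) with hA
  set LX : Finset (ZdEdge d) → ℝ := fun X => ∑ y ∈ X, lipV X y with hLXdef
  set g : ZdEdge d → ℝ := fun e => exp (-t * linkSetDist Δf e) with hg
  have hδ0 : 0 ≤ ∑ y ∈ Δf, δf y := sum_nonneg fun y _ => hδf.nonneg y
  have hA0 : 0 ≤ A := by positivity
  have hLX0 : ∀ X, 0 ≤ LX X := fun X => sum_nonneg fun y _ => (hlipV X).nonneg y
  have hg0 : ∀ e, 0 ≤ g e := fun e => (exp_pos _).le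
  have hd0 : 0 < d := hd
  have hL0 : 0 ≤ L :=
    le_trans (tsum_nonneg fun X => by split_ifs; exacts [hLX0 X, le_rfl]) (hL (0, ⟨0, hd0⟩))
  -- termwise: the door's bound, then the summable profile
  have hterm : ∀ X, |cov[f, V X; μ]| ≤ A * LX X * ∑ e ∈ X, g e := fun X => by
    obtain ⟨CX, hCX⟩ := hVb X
    have h1 := abs_cov_le_of_isLipBound_S hd hN hc hv hb hP hVB h hWc hWdep hosc hoscs hosca hlip hlips hℓ ht.le hℓs hℓt hρ
      hμ hfm hfdep hMf hδf (hVm X) (hVdep X) hCX (hlipV X)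
    refine le_mul_sum_exp_of_le_mul_exp ht.le hA0 (hLX0 X) (by simpa only [hA, hLXdef, mul_assoc, mul_comm, mul_left_comm] using h1)
      (fun hX => ?_) (fun hΔ => ?_)
    · simp only [hLXdef, Finset.not_nonempty_iff_eq_empty.1 hX, sum_empty]
    · simp only [hA, Finset.not_nonempty_iff_eq_empty.1 hΔ, sum_empty, mul_zero]
  -- partial sums
  have hpartial : ∀ T : Finset (Finset (ZdEdge d)), ∑ X ∈ T, |cov[f, V X; μ]| ≤
      A * L * (Δf.card * (d * ((1 + exp (-(t / d))) / (1 - exp (-(t / d)))) ^ d)) := by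
    intro T
    have h1 : ∑ X ∈ T, |cov[f, V X; μ]| ≤ A * ∑ X ∈ T, LX X * ∑ e ∈ X, g e := by
      rw [mul_sum]
      exact sum_le_sum fun X _ => (hterm X).trans (le_of_eq (by ring))
    refine h1.trans ?_
    by_cases hΔ : Δf.Nonempty
    · obtain ⟨hgs, hgt⟩ := summable_exp_neg_linkSetDist hd ht hΔ
      have h2 : ∑ X ∈ T, LX X * ∑ e ∈ X, g e ≤ L * (Δf.card * (d * ((1 + exp (-(t / d))) / (1 - exp (-(t / d)))) ^ d)) :=
        (sum_mul_sum_le_of_load hg0 hgs hLX0 hL0 hLs hL).trans (mul_le_mul_of_nonneg_left hgt hL0)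
      calc A * ∑ X ∈ T, LX X * ∑ e ∈ X, g e
          ≤ A * (L * (Δf.card * (d * ((1 + exp (-(t / d))) / (1 - exp (-(t / d)))) ^ d))) := mul_le_mul_of_nonneg_left h2 hA0
        _ = _ := by ring
    · have hA00 : A = 0 := by simp only [hA, Finset.not_nonempty_iff_eq_empty.1 hΔ, sum_empty, mul_zero]
      rw [hA00, zero_mul, zero_mul, zero_mul]
  exact ⟨summable_of_sum_le (fun _ => abs_nonneg _) hpartial, Real.tsum_le_of_sum_le (fun _ => abs_nonneg _) hpartial⟩

end Series

/-! ### `SU(2)`, `ℤ⁴`, uniformly on the weighted ball, hypothesis-free -/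

/-- **`SU(2)`, `ℤ⁴` — FINITE STATIC SUSCEPTIBILITY AGAINST EVERY DIRECTION, uniformly on `MemBallZdS a Λ t`.**  `0 < t`,
`6|β_W| e^{a} e^{t} + e^{a/2} √(2/3) Λ < 1` ⇒ for every member `W` (bare coupling `β_W/2`), EVERY DLR state `μ`, every Lipschitz cylinder
`F` (`Λ_F`, `K_F`) and every direction `V` (measurable bounded own-link terms, Frobenius-Lipschitz witnesses with total load `≤ L` through
every link): `Σ_X |cov_μ(F, V_X)| ≤ 16 · (#Λ_F · K_F) · L · (#Λ_F · 4 · ((1+e^{−t/4})/(1−e^{−t/4}))⁴)` (and the series is summable). -/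
theorem su2_summable_abs_cov_direction_dim4 {βW a Λ t : ℝ} (ht : 0 < t)
    (hρ : 6 * |βW| * (exp a * exp t) + exp (a / 2) * Real.sqrt (2 / 3) * Λ < 1)
    {W V : Potential (ZdEdge 4) (Matrix.specialUnitaryGroup (Fin 2) ℂ)} (hmem : MemBallZdS a Λ t W)
    {μ : Measure (LGConfig 4 (Matrix.specialUnitaryGroup (Fin 2) ℂ))}
    (hμ : μ ∈ perturbedGibbsMeasuresS (d := 4) (fundamentalRep (Fin 2)) (2 * (βW / 4)) W)
    {F : LGConfig 4 (Matrix.specialUnitaryGroup (Fin 2) ℂ) → ℝ} {ΛF : Finset (ZdEdge 4)} {KF : ℝ≥0}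
    (hF : IsLipschitzCylinder (fundamentalRep (Fin 2)) F ΛF KF)
    (hVm : ∀ X, Measurable (V X)) (hVdep : ∀ X, DependsOn (V X) (↑X : Set (ZdEdge 4)))
    (hVb : ∀ X, ∃ C, ∀ U, |V X U| ≤ C)
    {lipV : Finset (ZdEdge 4) → ZdEdge 4 → ℝ} (hlipV : ∀ X, IsLipBound suFrobDist (V X) (lipV X)) {L : ℝ}
    (hLs : ∀ e, Summable fun X : Finset (ZdEdge 4) => (if e ∈ X then ∑ y ∈ X, lipV X y else 0))
    (hL : ∀ e, ∑' X : Finset (ZdEdge 4), (if e ∈ X then ∑ y ∈ X, lipV X y else 0) ≤ L) :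
    Summable (fun X : Finset (ZdEdge 4) => |cov[F, V X; μ]|) ∧
      ∑' X : Finset (ZdEdge 4), |cov[F, V X; μ]| ≤
        16 * (ΛF.card * KF) * L * (ΛF.card * (4 * ((1 + exp (-(t / 4))) / (1 - exp (-(t / 4)))) ^ 4)) := by
  classical
  obtain ⟨BW, h⟩ := hmem.summable
  obtain ⟨osc, lip, ℓ, hosc, hlip, hoscs, hosca, hlips, hℓ, hℓs, hℓt⟩ := hmem.loads
  have hc : (0 : ℝ) ≤ 2 / 3 := by norm_num
  have hP : ∀ B : Matrix (Fin 2) (Fin 2) ℂ, matrixOpNorm B ≤ |βW / 4| * (2 * (((4 : ℕ) : ℝ) - 1)) →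
      ∀ (ψ : Matrix.specialUnitaryGroup (Fin 2) ℂ → ℝ) (M : ℝ), 0 ≤ M →
        (∀ x y, |ψ x - ψ y| ≤ M * suFrobDist x y) →
        Var[ψ; (haarProbability (Matrix.specialUnitaryGroup (Fin 2) ℂ)).tilted
          fun g => ((2 : ℕ) : ℝ) * ((g : Matrix (Fin 2) (Fin 2) ℂ) * B).trace.re] ≤ 2 / 3 * M ^ 2 :=
    fun B hB ψ M hM hψ => oneLinkPoincareSUN_two_sharp _ B hB ψ M hM hψ
  have hVB := linVariance_of_poincare (N := 2) hP
  have hv : (0 : ℝ) ≤ 2 / 3 * ((2 : ℕ) : ℝ) ^ 2 := by norm_num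
  have hsq : Real.sqrt (2 / 3 * (2 / 3 * ((2 : ℕ) : ℝ) ^ 2)) = 4 / 3 := by
    rw [show (2 / 3 * (2 / 3 * ((2 : ℕ) : ℝ) ^ 2) : ℝ) = (4 / 3) ^ 2 by norm_num, Real.sqrt_sq (by norm_num)]
  have hρ' : 6 * (((4 : ℕ) : ℝ) - 1) * |βW / 4| * (exp a * exp t * Real.sqrt (2 / 3 * (2 / 3 * ((2 : ℕ) : ℝ) ^ 2))) +
      exp (a / 2) * Real.sqrt (2 / 3) * Λ < 1 := by
    rw [hsq, abs_div, abs_of_pos (by norm_num : (0 : ℝ) < 4)]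
    have : 6 * (((4 : ℕ) : ℝ) - 1) * (|βW| / 4) * (exp a * exp t * (4 / 3)) = 6 * |βW| * (exp a * exp t) := by norm_num; ring
    rw [this]; exact hρ
  have hμ' : μ ∈ perturbedGibbsMeasuresS (d := 4) (fundamentalRep (Fin 2)) ((2 : ℕ) * (βW / 4)) W := by simpa using hμ
  have hA : ∀ a b : Matrix.specialUnitaryGroup (Fin 2) ℂ, dist (suEntries a) (suEntries b) ≤ 1 * suFrobDist a b :=
    fun a b => by rw [one_mul]; exact dist_suEntries_le_suFrobDist a b
  have key := summable_abs_cov_direction_S (N := 2) (d := 4) (by norm_num) (by norm_num) hc hv le_rfl hP hVB h hmem.continuous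
    hmem.dependsOn hosc hoscs hosca hlip hlips hℓ ht hℓs hℓt hρ' hμ' hF.measurable hF.dependsOn hF.abs_le
    (hF.isLipBound zero_le_one hA) hVm hVdep hVb hlipV hLs hL
  refine ⟨key.1, key.2.trans (le_of_eq ?_)⟩
  have h2 : Real.sqrt ((2 : ℕ) : ℝ) ^ 2 = 2 := by rw [Real.sq_sqrt (by norm_num)]; norm_num
  have hsum : ∑ y ∈ ΛF, (if y ∈ ΛF then (1 : ℝ) * (KF : ℝ) else 0) = ΛF.card * KF := by
    rw [Finset.sum_congr rfl fun y hy => by rw [if_pos hy, one_mul], Finset.sum_const, nsmul_eq_mul]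
  rw [hsum, mul_pow, h2]
  norm_num

end Summit.Ventures.YMGap.RobustBall

end
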